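import Summits.BirchSwinnertonDyer.Rank1Residual.X11a.PrintDischarge
import Literature.NumberTheory.EllipticCurves.Fouquet2025.CongruenceTransportFromBCSSeedProofs
import HarnessLib

/-!
# Class X11a — the PRINT route's discharge interface, part 2: the Fouquet 2025 + BCS-seed road
# (congruence transport IN PRINT; cell `bsd-print-x11a`, seat ty2; D-0131 (2))

PARTITION CURRENCY: leaf `ClassX11a W p := W.analyticRank = 0 ∧ p ≠ 2 ∧ Mult W p ∧ Irr W p ∧ ¬ Ram W p`
(`Partition/Rows.lean`; LADDER-BSD K2 row A9). THEOREMS ONLY: no definition, no named fact, nothing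
asserted; the published inputs are the explicit named-fact hypotheses `hA`/`hAσ` (Fouquet 2025),
`hBCS` (Burungale–Castella–Skinner 2025 Thm. 1.1.2 (b)), `hmodf` (modularity `exists_isNewformOf`),
`hmod`, `hGZK`. Companion of `X11a/PrintDischarge.lean` (atoms, walls, image, Skinner / Kato–Wuthrich
/ visibility bundles, output glue).

THE ROAD (strategy p2's "transport `BSD_p` back along a congruence" in its PRINTED form, no (ram)
anywhere). Fouquet, Tunisian J. Math. 7 (2025) Thm. 4.1 (1)⇒(2) + Thm. 1.7 (2): the `p`-part of BSD
in analytic rank `0` for a target `W` of ANY reduction type at `p ≥ 5`, transported from a congruent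
partner at which the cyclotomic main identity holds; with the identity at a good-ORDINARY elliptic
partner `G` with big `p`-adic image supplied by BCS 2025 Thm. 1.1.2 (b) (tree theorems
`Fouquet2025.padicValRat_bsd_rank_zero_of_congruence_of_bcsSeed{,_sigma}`). ON X11a the TARGET-side
hypotheses read (this file):

| Fouquet binder on `W` (tree spelling) | on `ClassX11a W p` | lemma |
|---|---|---|
| `5 ≤ p` | ⟺ `p ≠ 3` | `ClassX11a.five_le_of_ne_three` (part 1) |
| Ass. 2.9 (1): `W.HasSurjectiveModNGaloisRep p` | PER-PAIR BIT (theorem at `p ≥ 11`, or très ramifié, or semistable: part 1) | `hsurj` |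
| Ass. 2.9 (2): `∀ x : ℚ_[p], ΨSq_p(x) ≠ 0` | PER-PAIR BIT (fails iff `ρ̄∣G_ℚₚ` splits) | `hΨ` |
| Ass. 3.4 (Tate form) `Assumption34TateAt p W` | ⟺ every multiplicative `q ≠ p` is ODD and, if `q ≡ 1 (mod p)`, the Kummer clause — the premise "`E[p]` unramified at `q`" is AUTOMATIC on X11a (`dvd_padicValInt_of_mult`) | `assumption34TateAt_iff`; wall `not_assumption34TateAt_of_mult_two` |
| `W.entireLFunction 1 ≠ 0`, `Finite W.sha` | implied (`hmod`, `hGZK`) | part 1 / Cells |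

and the PARTNER side (`G` good ordinary at `p`, `ρ_{G,p^n}` onto, the congruence off `p·N_W·N_G`,
level compatibility resp. `Assumption34TateAt p G`) stays PER PAIR (certificate record). Since
`G[p] ≅ W[p]` must be finite at `p` for a good-at-`p` partner to exist, the road lives on the peu
ramifié locus `p ∣ v_p(Δ_min)`; and since `W[p]∣G_ℚₚ` has an unramified quotient character `η` with
`η² = 1`, every partner has `a_p(G)² ≡ 1 (mod p)`, so the provenance flag recorded in the ADDENDA of the
Fouquet fact files (`@Fouquet-2.10-via-ColmezWang-PRE`) travels with EVERY X11a row of this road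
(referee pricing; nothing here is counted by this file). Closing forms: `bsdp_of_fouquet_bcsSeed`
(strict `Σ`) and `bsdp_of_fouquet_bcsSeed_sigma` (level-raised partners).

References: [Fouquet2025EquivariantTNC] Ass. 2.9 (p. 15), Ass. 3.4 (pp. 22–23), Thm. 4.1 (pp. 24–25),
Thm. 1.7 (2) (p. 7), §2.2 (p. 12); [BurungaleCastellaSkinner2025] Thm. 1.1.2 (b); tree files
`Fouquet2025/CongruenceTransportAnyReduction.lean`, `…/CongruenceTransportFromBCSSeedProofs.lean`,
`X11a/PrintDischarge.lean`.
-/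

set_option autoImplicit false

noncomputable section

open scoped Classical

open WeierstrassCurve Literature.NumberTheory.EllipticCurves
  Literature.NumberTheory.EllipticCurves.ModularForms
  Literature.NumberTheory.EllipticCurves.Rank1Residual
  Literature.NumberTheory.EllipticCurves.Rank1Residual.Typed
  Literature.NumberTheory.EllipticCurves.Fouquet2025

namespace Summit.BirchSwinnertonDyer.Rank1Residual.X11a

variable {W : WeierstrassCurve ℚ} [W.IsElliptic] [W.IsGloballyMinimal] {p : ℕ} [Fact p.Prime]

/-! ### §1 Fouquet's assumptions on the target, read on the leaf -/

omit [W.IsElliptic] in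
/-- **Fouquet 2025 Ass. 3.4 in Tate form ON X11a**: since `E[p]` is unramified at EVERY
multiplicative `q ≠ p` (`dvd_padicValInt_of_mult`), `Assumption34TateAt p W` reads: every
multiplicative prime `q ≠ p` is odd, and at those with `q ≡ 1 (mod p)` the Kummer clause (5)(b)
holds (`ρ̄(Frob_q)` not diagonalizable: the unit part of the Tate parameter is not a `p`-th power mod
`q`). These are the per-pair bits of the certificate record; nothing else of Ass. 3.4 is asked of `W`.
[cite: Fouquet2025EquivariantTNC, Ass. 3.4 (pp. 22–23), cases 2, 3 (b), 5 (b)] -/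
theorem _root_.Summit.BirchSwinnertonDyer.Rank1Residual.ClassX11a.assumption34TateAt_iff
    (hX : ClassX11a W p) :
    Assumption34TateAt p W ↔
      ∀ (q : ℕ) [Fact q.Prime], q ≠ p → W.HasMultiplicativeReductionAtPrime q →
        q ≠ 2 ∧ (q % p = 1 →
          ¬ ∃ x : ZMod q, x ^ p * ((W.integralModelInt.c₄ ^ 3 : ℤ) : ZMod q) =
            ((W.minimalDiscriminantInt / (q : ℤ) ^ padicValInt q W.minimalDiscriminantInt : ℤ) :
              ZMod q)) := by
  constructor
  · intro h q _ hqp hmult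
    exact h q hqp hmult (hX.dvd_padicValInt_of_mult hqp hmult)
  · intro h q _ hqp hmult _
    exact h q hqp hmult

omit [W.IsElliptic] in
/-- **Wall (Fouquet road)**: an X11a pair with `2 ‖ N` violates Ass. 3.4 ("if `ℓ ∤ p` belongs to
`Σ ∖ Σ(ρ̄)` then it is odd": here `E[p]` is unramified at the multiplicative prime `2`). Boundary
statement for the referee / census: such pairs are outside `bsdp_of_fouquet_bcsSeed`.
[cite: Fouquet2025EquivariantTNC, Ass. 3.4 (p. 22), first clause ("it is odd")] -/
theorem _root_.Summit.BirchSwinnertonDyer.Rank1Residual.ClassX11a.not_assumption34TateAt_of_mult_two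
    (hX : ClassX11a W p) (h2 : W.HasMultiplicativeReductionAtPrime 2) :
    ¬ Assumption34TateAt p W := by
  haveI : Fact (Nat.Prime 2) := ⟨Nat.prime_two⟩
  intro h
  exact (h 2 (Ne.symm hX.ne_two) h2 (hX.dvd_padicValInt_of_mult (Ne.symm hX.ne_two) h2)).1 rfl

/-- **Fouquet 2025 — the TARGET-side hypothesis tuple** of
`Fouquet2025.padicValRat_bsd_rank_zero_of_congruence_of_seedMainIdentity{,_sigma}` / of the BCS-seed
theorems, in their order: `5 ≤ p`, `ρ̄_{W,p}` onto, `ΨSq_p` rootless over `ℚ_p`, `Assumption34TateAt p W`,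
`L(W,1) ≠ 0`, `Ш(W)` finite — from the class, `p ≠ 3`, and the three per-pair bits (mod-`p` image,
Ass. 2.9 (2), Ass. 3.4 per multiplicative `q ≠ p`). The PARTNER-side data (`G`, its ordinarity and
`p`-adic image, the congruence, level compatibility) are per-pair certificate items.
[cite: Fouquet2025EquivariantTNC, Ass. 2.9 (p. 15), Ass. 3.4 (pp. 22–23), Thm 4.1 (pp. 24–25), Thm 1.7 (2) (p. 7)] -/
theorem _root_.Summit.BirchSwinnertonDyer.Rank1Residual.ClassX11a.fouquetTarget_hypotheses
    (hmod : hasEntireLFunction_rat) (hGZK : rank_eq_analyticRank_of_analyticRank_le_one)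
    (hX : ClassX11a W p) (h3 : p ≠ 3) (hsurj : Surj W p)
    (hΨ : ∀ x : ℚ_[p], ((W.baseChange ℚ_[p]).ΨSq (p : ℤ)).eval x ≠ 0)
    (h34 : ∀ (q : ℕ) [Fact q.Prime], q ≠ p → W.HasMultiplicativeReductionAtPrime q →
      q ≠ 2 ∧ (q % p = 1 →
        ¬ ∃ x : ZMod q, x ^ p * ((W.integralModelInt.c₄ ^ 3 : ℤ) : ZMod q) =
          ((W.minimalDiscriminantInt / (q : ℤ) ^ padicValInt q W.minimalDiscriminantInt : ℤ) :
            ZMod q))) :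
    5 ≤ p ∧ W.HasSurjectiveModNGaloisRep p ∧
      (∀ x : ℚ_[p], ((W.baseChange ℚ_[p]).ΨSq (p : ℤ)).eval x ≠ 0) ∧
      Assumption34TateAt p W ∧ W.entireLFunction 1 ≠ 0 ∧ Finite W.sha :=
  ⟨hX.five_le_of_ne_three h3, hsurj, hΨ, (hX.assumption34TateAt_iff).mpr h34, hX.L_one_ne_zero hmod,
    hX.finite_sha hGZK⟩

/-! ### §2 Closing forms BY NAME with the pair side discharged (partner data per pair) -/

/-- **Fouquet 2025 Thm. 4.1 (1)⇒(2) + Burungale–Castella–Skinner 2025 Thm. 1.1.2 (b) at a congruent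
good-ordinary partner ⇒ `BSD(E,p)` on X11a** (strict `Σ`: level-compatible partner). Named facts:
`hA` (Fouquet, transport with the seed's main identity as hypothesis), `hBCS` (BCS Thm. 1.1.2 (b)),
`hmodf` (modularity: the partner's newform), `hmod`, `hGZK`. Pair side: the class, `p ≠ 3`, the
mod-`p` image bit, Ass. 2.9 (2) as the `ΨSq_p` clause, the Ass. 3.4 bits at the multiplicative
`q ≠ p`. Partner side (per pair): `G` good ordinary at `p` with `ρ_{G,p^n}` onto for all `n`,
`a_ℓ(W) ≡ a_ℓ(G) (mod p)` off `p·N_W·N_G`, `supp(N_G) ∖ {p} ⊆ supp(N_W)`. Referee flags travel with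
the two fact names (Fouquet Thm. 2.10 provenance on rows with `a_p(G)² ≡ 1 (mod p)` — which is EVERY
row here, `G[p] ≅ W[p]` being of multiplicative type at `p`; BCS via Wan 2015).
[cite: Fouquet2025EquivariantTNC, Thm 4.1 (1)⇒(2) (pp. 24–25), Thm 1.7 (2) (p. 7), §2.2 (p. 12)]
[cite: BurungaleCastellaSkinner2025, Thm 1.1.2 (b) (p. 2 of arXiv:2405.00270v2)] -/
theorem bsdp_of_fouquet_bcsSeed
    (hA : padicValRat_bsd_rank_zero_of_congruence_of_seedMainIdentity)
    (hBCS : burungale_castella_skinner_charIdeal_eq_padicLFunction_integral)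
    (hmodf : exists_isNewformOf) (hmod : hasEntireLFunction_rat)
    (hGZK : rank_eq_analyticRank_of_analyticRank_le_one)
    (hX : ClassX11a W p) (h3 : p ≠ 3) (hsurj : Surj W p)
    (hΨ : ∀ x : ℚ_[p], ((W.baseChange ℚ_[p]).ΨSq (p : ℤ)).eval x ≠ 0)
    (h34 : ∀ (q : ℕ) [Fact q.Prime], q ≠ p → W.HasMultiplicativeReductionAtPrime q →
      q ≠ 2 ∧ (q % p = 1 →
        ¬ ∃ x : ZMod q, x ^ p * ((W.integralModelInt.c₄ ^ 3 : ℤ) : ZMod q) =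
          ((W.minimalDiscriminantInt / (q : ℤ) ^ padicValInt q W.minimalDiscriminantInt : ℤ) :
            ZMod q)))
    (G : WeierstrassCurve ℚ) [G.IsElliptic] [G.IsGloballyMinimal]
    (hGgood : G.HasGoodReductionAtPrime p) (hGord : ¬ (p : ℤ) ∣ G.frobeniusTrace p)
    (hGbig : ∀ n : ℕ, G.HasSurjectiveModNGaloisRep (p ^ n : ℕ))
    (hcong : ∀ ℓ : ℕ, ℓ.Prime → ¬ (ℓ ∣ p * W.conductorNorm ℤ * G.conductorNorm ℤ) →
      ((W.LFunction ℓ : ℤ) : ZMod p) = ((G.LFunction ℓ : ℤ) : ZMod p))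
    (hlev : ∀ q : ℕ, q.Prime → q ≠ p → (q : ℤ) ∣ G.conductorNorm ℤ → (q : ℤ) ∣ W.conductorNorm ℤ) :
    BSDp W p := by
  obtain ⟨h5, hs, hΨ', h34', hL, hfin⟩ := hX.fouquetTarget_hypotheses hmod hGZK h3 hsurj hΨ h34
  exact hX.bsdp_of_padicValRat hmod hGZK
    (padicValRat_bsd_rank_zero_of_congruence_of_bcsSeed hA hBCS hmodf W G p h5 hs hΨ' h34' hGgood
      hGord hGbig hcong hlev hL hfin)

/-- **The same over the enlarged `Σ` (level-raised partners)**: the level-compatibility binder is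
replaced by `Assumption34TateAt p G` on the partner (fact `hAσ` =
`Fouquet2025.padicValRat_bsd_rank_zero_of_congruence_of_seedMainIdentity_sigma`).
[cite: Fouquet2025EquivariantTNC, Thm 4.1 (1)⇒(2) (pp. 24–25), Thm 1.7 (2) (p. 7), Ass. 3.4 (pp. 22–23)]
[cite: BurungaleCastellaSkinner2025, Thm 1.1.2 (b) (p. 2 of arXiv:2405.00270v2)] -/
theorem bsdp_of_fouquet_bcsSeed_sigma
    (hAσ : padicValRat_bsd_rank_zero_of_congruence_of_seedMainIdentity_sigma)
    (hBCS : burungale_castella_skinner_charIdeal_eq_padicLFunction_integral)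
    (hmodf : exists_isNewformOf) (hmod : hasEntireLFunction_rat)
    (hGZK : rank_eq_analyticRank_of_analyticRank_le_one)
    (hX : ClassX11a W p) (h3 : p ≠ 3) (hsurj : Surj W p)
    (hΨ : ∀ x : ℚ_[p], ((W.baseChange ℚ_[p]).ΨSq (p : ℤ)).eval x ≠ 0)
    (h34 : ∀ (q : ℕ) [Fact q.Prime], q ≠ p → W.HasMultiplicativeReductionAtPrime q →
      q ≠ 2 ∧ (q % p = 1 →
        ¬ ∃ x : ZMod q, x ^ p * ((W.integralModelInt.c₄ ^ 3 : ℤ) : ZMod q) =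
          ((W.minimalDiscriminantInt / (q : ℤ) ^ padicValInt q W.minimalDiscriminantInt : ℤ) :
            ZMod q)))
    (G : WeierstrassCurve ℚ) [G.IsElliptic] [G.IsGloballyMinimal] (h34G : Assumption34TateAt p G)
    (hGgood : G.HasGoodReductionAtPrime p) (hGord : ¬ (p : ℤ) ∣ G.frobeniusTrace p)
    (hGbig : ∀ n : ℕ, G.HasSurjectiveModNGaloisRep (p ^ n : ℕ))
    (hcong : ∀ ℓ : ℕ, ℓ.Prime → ¬ (ℓ ∣ p * W.conductorNorm ℤ * G.conductorNorm ℤ) →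
      ((W.LFunction ℓ : ℤ) : ZMod p) = ((G.LFunction ℓ : ℤ) : ZMod p)) :
    BSDp W p := by
  obtain ⟨h5, hs, hΨ', h34', hL, hfin⟩ := hX.fouquetTarget_hypotheses hmod hGZK h3 hsurj hΨ h34
  exact hX.bsdp_of_padicValRat hmod hGZK
    (padicValRat_bsd_rank_zero_of_congruence_of_bcsSeed_sigma hAσ hBCS hmodf W G p h5 hs hΨ' h34'
      h34G hGgood hGord hGbig hcong hL hfin)

end Summit.BirchSwinnertonDyer.Rank1Residual.X11a

end
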